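import Literature.MathematicalPhysics.QuantumFieldTheory.Balaban1983to89.B4RandomWalk213
import Literature.MathematicalPhysics.QuantumFieldTheory.Balaban1983to89.B4PartitionUnity22

/-!
# `Balaban1983to89.B4Eq213Locality` — [Balaban1983RegularityDecay] p. 577, the support fact behind the random-walk
representation (2.13): «G_k(□_j,Ã_j)h_jK_{j′}G_k(□_{j′},Ã_{j′}) = 0, if |j − j′| = max_μ|j_μ − j′_μ| > 1», PROVED for the
concrete partition of unity of `B4PartitionUnity22`

statement-level skeleton of published theorems with citation tags; proofs where landed; nothing here is a claim about the Yang–Mills mass gap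

CITATION HEADER.  T. Bałaban, *Regularity and decay of lattice Green's functions*, Commun. Math. Phys. **89** (1983)
571–597, doi:10.1007/bf01214744 [Balaban1983RegularityDecay] (cell paper B4; held text
`paper:balaban1983-cmp89-regularity-decay`, journal page = PDF page + 570; p. 577 read from the page render
`b2b-balaban-ref1/pages/1983-cmp89-regularity-decay/…-p007-x2.png`).  Unit `lit-balaban-r01` gen 5 (B4 fold owner),
HOME `run/shared/lean/pub/lit-balaban/`, SKELETON rows **B4.Eq2.12** ((2.12)–(2.13); «proved-existing at the abstract
operator-ring level (locality + Neumann series ⇒ walk sum)» — the LOCALITY being a hypothesis of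
`B4RandomWalk213.lattice_walk_decay_bound` (`hab`, `hbb`) and of `B4Commutators25to211` §5) and **B4.Def§2**
(`B4PartitionUnity22`, p251869).  Theorems only; imports `B4RandomWalk213` (the adjacency `cubeAdj`) and
`B4PartitionUnity22` (the concrete `h_j = hCube M j`, which imports `B4Commutators25to211`: `mulH`, `opK`, `covLapKer`).

WHAT IS PRINTED (verbatim, p. 577).  *«We can write (2.13) G_k(Ω,A) = Σ_ω h_{ω₀}G_k(□_{ω₀},Ã_{ω₀})h_{ω₀}K_{ω₁}G_k(□_{ω₁},
Ã_{ω₁})h_{ω₁} … K_{ω_n}G_k(□_{ω_n},Ã_{ω_n})h_{ω_n}, and this representation follows from (2.12) and the obvious fact that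
G_k(□_j,Ã_j)h_jK_{j′}G_k(□_{j′},Ã_{j′}) = 0, if |j − j′| = max_μ|j_μ − j′_μ| > 1.»*

WHAT THIS MODULE PROVES (all in full; generic finite site set `X` with positions `pos : X → ℝ^d`, internal index `κ`,
block index `Y`, any bond weights `c`, links `W`, block weights `q`, transporters `T`, mass `m²`, coupling `a`).
* `mulH_hCube_mul_opK_eq_zero` — THE CORE: `h_i · K_l = 0` (`mulH(h_i) * opK(h_l) = 0`, `K_l = [h_l, H]` of (2.10),
  `H = −Δ_W + m² + aQ^*Q` the operator (1.6)) whenever `¬(∀ μ, |i_μ − l_μ| ≤ 1)`, PROVIDED the data are local at scale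
  `(3/4)M`: `c(z,z′) ≠ 0 ⇒ |pos z − pos z′|_∞ ≤ (3/4)M` (in [B4]: nearest-neighbour bonds, distance `η`) and
  `q(y,z) ≠ 0 ≠ q(y,z′) ⇒ |pos z − pos z′|_∞ ≤ (3/4)M` (in [B4]: two sites of one unit block `B^k(y)`, distance `< 1`;
  so any `M ≥ 4/3` qualifies).  Proof: the kernel of `h_iK_l` is `h_i(z)(h_l(z) − h_l(z′))K(z,z′)`
  (`B4Commutators25to211.opK_eq_blockOp`, `mulH_mul_blockOp`); `supp h_j ⊂ {|x_μ − Mj_μ| < (5/8)M}` makes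
  `h_i(z) ≠ 0 ≠ h_l(z)` or (`h_i(z) ≠ 0 ≠ h_l(z′)`, `z ~ z′`) force `|i − l|_∞ ≤ 1`
  (`B4PartitionUnity22.hCube_labels_adjacent`), so for non-neighbours every block of the kernel vanishes.
* `green_mulH_opK_green_eq_zero` — the printed shape `G_i h_i K_l G_l = 0` for ANY operators `G_i`, `G_l`.
* `a_mul_b_eq_zero`, `b_mul_b_eq_zero` — the two LOCALITY hypotheses of `B4RandomWalk213.walk_decay_bound` /
  `lattice_walk_decay_bound` (`¬cubeAdj j j′ → a j * b j′ = 0 ∧ b j * b j′ = 0`, `a j = h_jG_jh_j` (2.2),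
  `b j = K_jG_jh_j` (2.11)) in matrix form, for the concrete `h_j` and any `G_j`.
* `cubeAdj_id_iff`, `mulH_hCube_mul_opK_eq_zero_of_not_cubeAdj` — the same with [B4]'s adjacency predicate
  `B4RandomWalk213.cubeAdj` on labels `j ∈ Z^d`.

HONEST SCOPE.  Nothing analytic (no norm bound on `K_j`, no convergence of (2.12)); the locality (2.6)
`H·h_j = H_j·h_j` of `B4Commutators25to211` §5 (Neumann cubes `□_j ⊂ Ω`) is NOT discharged here; the passage from these
matrix identities to the normed-ring letters `a j`, `b j` of `B4RandomWalk213` is the identity map on matrices (any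
sub-multiplicative matrix norm).  No `def`, no `Prop` fact, no `sorry`; axioms standard.
-/

namespace Literature.MathematicalPhysics.QuantumFieldTheory.Balaban1983to89.B4Eq213Locality

open Literature.MathematicalPhysics.QuantumFieldTheory.Balaban1983to89.B4GaugeCovariance
open Literature.MathematicalPhysics.QuantumFieldTheory.Balaban1983to89.B4Commutators25to211
open Literature.MathematicalPhysics.QuantumFieldTheory.Balaban1983to89.B4PartitionUnity22
open scoped Matrix

variable {X Y κ ι : Type*} [Fintype X] [Fintype Y] [Fintype κ] [DecidableEq X] [DecidableEq κ] [Fintype ι]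

/-- a multiplication operator followed by a block operator vanishes when, blockwise, the multiplier or the block
vanishes. [cite: Balaban1983RegularityDecay, (2.13) p.577] -/
theorem mulH_mul_blockOp_eq_zero (g : X → ℝ) (K : X → X → Matrix κ κ ℝ)
    (h : ∀ z z', g z = 0 ∨ K z z' = 0) : mulH (ι := κ) g * blockOp K = 0 := by
  rw [mulH_mul_blockOp, ← blockOp_zero]
  congr 1
  funext z z'
  rcases h z z' with h0 | h0
  · rw [h0, zero_smul]; rfl
  · rw [h0, smul_zero]; rfl

/-- **«the obvious fact that G_k(□_j,Ã_j)h_jK_{j′}G_k(□_{j′},Ã_{j′}) = 0, if |j − j′| = max_μ|j_μ − j′_μ| > 1»**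
(p. 577), its core for the CONCRETE partition of unity `h_j = B4PartitionUnity22.hCube M j ∘ pos`: the product
`h_i · K_l` of the multiplication operator by `h_i` with [B4]'s commutator `K_l = [h_l, H]` (2.10)
(`B4Commutators25to211.opK`, `H = −Δ_W + m² + aQ^*Q` the operator (1.6) on ANY finite site set `X` with positions
`pos : X → ℝ^d`) VANISHES whenever the labels are not neighbours — provided the data are LOCAL at scale `(3/4)M`:
a bond weight `c(z,z′) ≠ 0` only for sites within `(3/4)M` of each other in every coordinate (nearest-neighbour
bonds: distance `η`), and two sites of a common averaging block (`q(y,z) ≠ 0 ≠ q(y,z′)`) are within `(3/4)M` (unit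
blocks: distance `< 1`).  Mechanism: the kernel of `h_iK_l` at `(z,z′)` is `h_i(z)(h_l(z) − h_l(z′))K(z,z′)`
(`opK_eq_blockOp`); `h_i(z) ≠ 0 ≠ h_l(z)` or `h_i(z) ≠ 0 ≠ h_l(z′)` with `z, z′` coupled forces `|i − l|_∞ ≤ 1`
(`B4PartitionUnity22.hCube_labels_adjacent`). [cite: Balaban1983RegularityDecay, (2.13) p.577] -/
theorem mulH_hCube_mul_opK_eq_zero {M : ℝ} (hM : 0 < M) (pos : X → ι → ℝ) (c : X → X → ℝ) (m2 a : ℝ)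
    (q : Y → X → ℝ) (W : X → X → Matrix κ κ ℝ) (T : Y → X → Matrix κ κ ℝ)
    (hc : ∀ z z', c z z' ≠ 0 → ∀ μ, |pos z μ - pos z' μ| ≤ 3 / 4 * M)
    (hq : ∀ y z z', q y z ≠ 0 → q y z' ≠ 0 → ∀ μ, |pos z μ - pos z' μ| ≤ 3 / 4 * M)
    {i l : ι → ℤ} (hil : ¬ ∀ μ, |i μ - l μ| ≤ 1) :
    mulH (ι := κ) (fun z => hCube M i (pos z)) * opK c m2 a q W T (fun z => hCube M l (pos z)) = 0 := by
  rw [opK_eq_blockOp]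
  apply mulH_mul_blockOp_eq_zero
  intro z z'
  by_cases hi : hCube M i (pos z) = 0
  · exact Or.inl hi
  right
  -- `h_i(z) ≠ 0`; then `h_l(z) = 0` (same point) …
  have hlz : hCube M l (pos z) = 0 := by
    by_contra hl
    exact hil (hCube_labels_adjacent hM hi hl (fun μ => by
      rw [sub_self, abs_zero]; positivity))
  by_cases hlz' : hCube M l (pos z') = 0
  · rw [hlz, hlz', sub_zero, zero_smul]
  -- … and `h_l(z′) ≠ 0` forces every coupling `z ~ z′` to vanish
  have hfar : ¬ ∀ μ, |pos z μ - pos z' μ| ≤ 3 / 4 * M := fun hzz =>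
    hil (hCube_labels_adjacent hM hi hlz' hzz)
  have hzz' : z ≠ z' := by
    rintro rfl
    exact hlz' hlz
  have hc1 : c z z' = 0 := by
    by_contra h0
    exact hfar (hc z z' h0)
  have hc2 : c z' z = 0 := by
    by_contra h0
    apply hfar
    intro μ
    rw [abs_sub_comm]
    exact hc z' z h0 μ
  have hK : covLapKer c W z z' = 0 := by
    rw [covLapKer, if_neg hzz', if_neg hzz', hc1, hc2]
    simp
  have hP : ∑ y, (q y z * q y z') • ((T y z)ᵀ * T y z') = 0 := by
    refine Finset.sum_eq_zero fun y _ => ?_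
    have : q y z * q y z' = 0 := by
      by_contra h0
      rcases mul_ne_zero_iff.mp h0 with ⟨h1, h2⟩
      exact hfar (hq y z z' h1 h2)
    rw [this, zero_smul]
  rw [hK, hP, smul_zero, add_zero, smul_zero]

/-- **«G_k(□_j,Ã_j)h_jK_{j′}G_k(□_{j′},Ã_{j′}) = 0, if |j − j′| > 1»** (p. 577) VERBATIM SHAPE, for the concrete
`h_j` and ANY operators `G_j`, `G_{j′}` (in [B4]: the propagators `G_k(□_j,Ã_j) = H_j^{−1}`), under the locality of
the data at scale `(3/4)M`. [cite: Balaban1983RegularityDecay, (2.13) p.577] -/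
theorem green_mulH_opK_green_eq_zero {M : ℝ} (hM : 0 < M) (pos : X → ι → ℝ) (c : X → X → ℝ) (m2 a : ℝ)
    (q : Y → X → ℝ) (W : X → X → Matrix κ κ ℝ) (T : Y → X → Matrix κ κ ℝ)
    (hc : ∀ z z', c z z' ≠ 0 → ∀ μ, |pos z μ - pos z' μ| ≤ 3 / 4 * M)
    (hq : ∀ y z z', q y z ≠ 0 → q y z' ≠ 0 → ∀ μ, |pos z μ - pos z' μ| ≤ 3 / 4 * M)
    {i l : ι → ℤ} (hil : ¬ ∀ μ, |i μ - l μ| ≤ 1) (Gi Gl : Matrix (X × κ) (X × κ) ℝ) :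
    Gi * mulH (ι := κ) (fun z => hCube M i (pos z)) * opK c m2 a q W T (fun z => hCube M l (pos z)) * Gl = 0 := by
  rw [Matrix.mul_assoc Gi, mulH_hCube_mul_opK_eq_zero hM pos c m2 a q W T hc hq hil, Matrix.mul_zero,
    Matrix.zero_mul]

/-- THE LOCALITY HYPOTHESIS `hab` of `B4RandomWalk213.lattice_walk_decay_bound` / `walk_decay_bound`
(`¬ cubeAdj j j′ → a j * b j′ = 0` with `a j = h_jG_jh_j` (2.2), `b j = K_jG_jh_j` (2.11)), in matrix form for the
concrete partition of unity: `(h_iG_ih_i)(K_lG_lh_l) = 0` for non-neighbours. [cite: Balaban1983RegularityDecay, (2.13) p.577] -/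
theorem a_mul_b_eq_zero {M : ℝ} (hM : 0 < M) (pos : X → ι → ℝ) (c : X → X → ℝ) (m2 a : ℝ)
    (q : Y → X → ℝ) (W : X → X → Matrix κ κ ℝ) (T : Y → X → Matrix κ κ ℝ)
    (hc : ∀ z z', c z z' ≠ 0 → ∀ μ, |pos z μ - pos z' μ| ≤ 3 / 4 * M)
    (hq : ∀ y z z', q y z ≠ 0 → q y z' ≠ 0 → ∀ μ, |pos z μ - pos z' μ| ≤ 3 / 4 * M)
    {i l : ι → ℤ} (hil : ¬ ∀ μ, |i μ - l μ| ≤ 1) (Gi Gl : Matrix (X × κ) (X × κ) ℝ) :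
    (mulH (ι := κ) (fun z => hCube M i (pos z)) * Gi * mulH (ι := κ) (fun z => hCube M i (pos z)))
      * (opK c m2 a q W T (fun z => hCube M l (pos z)) * Gl * mulH (ι := κ) (fun z => hCube M l (pos z))) = 0 := by
  have h := mulH_hCube_mul_opK_eq_zero (κ := κ) hM pos c m2 a q W T hc hq hil
  rw [show mulH (ι := κ) (fun z => hCube M i (pos z)) * Gi * mulH (ι := κ) (fun z => hCube M i (pos z))
        * (opK c m2 a q W T (fun z => hCube M l (pos z)) * Gl * mulH (ι := κ) (fun z => hCube M l (pos z)))
      = mulH (ι := κ) (fun z => hCube M i (pos z)) * Gi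
        * (mulH (ι := κ) (fun z => hCube M i (pos z)) * opK c m2 a q W T (fun z => hCube M l (pos z)))
        * Gl * mulH (ι := κ) (fun z => hCube M l (pos z)) by
      simp only [Matrix.mul_assoc], h, Matrix.mul_zero, Matrix.zero_mul, Matrix.zero_mul]

/-- THE LOCALITY HYPOTHESIS `hbb` of `B4RandomWalk213.lattice_walk_decay_bound` (`¬ cubeAdj j j′ → b j * b j′ = 0`,
`b j = K_jG_jh_j`), in matrix form for the concrete partition of unity: `(K_iG_ih_i)(K_lG_lh_l) = 0` for
non-neighbours. [cite: Balaban1983RegularityDecay, (2.13) p.577] -/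
theorem b_mul_b_eq_zero {M : ℝ} (hM : 0 < M) (pos : X → ι → ℝ) (c : X → X → ℝ) (m2 a : ℝ)
    (q : Y → X → ℝ) (W : X → X → Matrix κ κ ℝ) (T : Y → X → Matrix κ κ ℝ)
    (hc : ∀ z z', c z z' ≠ 0 → ∀ μ, |pos z μ - pos z' μ| ≤ 3 / 4 * M)
    (hq : ∀ y z z', q y z ≠ 0 → q y z' ≠ 0 → ∀ μ, |pos z μ - pos z' μ| ≤ 3 / 4 * M)
    {i l : ι → ℤ} (hil : ¬ ∀ μ, |i μ - l μ| ≤ 1) (Gi Gl : Matrix (X × κ) (X × κ) ℝ) :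
    (opK c m2 a q W T (fun z => hCube M i (pos z)) * Gi * mulH (ι := κ) (fun z => hCube M i (pos z)))
      * (opK c m2 a q W T (fun z => hCube M l (pos z)) * Gl * mulH (ι := κ) (fun z => hCube M l (pos z))) = 0 := by
  have h := mulH_hCube_mul_opK_eq_zero (κ := κ) hM pos c m2 a q W T hc hq hil
  rw [show opK c m2 a q W T (fun z => hCube M i (pos z)) * Gi * mulH (ι := κ) (fun z => hCube M i (pos z))
        * (opK c m2 a q W T (fun z => hCube M l (pos z)) * Gl * mulH (ι := κ) (fun z => hCube M l (pos z)))
      = opK c m2 a q W T (fun z => hCube M i (pos z)) * Gi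
        * (mulH (ι := κ) (fun z => hCube M i (pos z)) * opK c m2 a q W T (fun z => hCube M l (pos z)))
        * Gl * mulH (ι := κ) (fun z => hCube M l (pos z)) by
      simp only [Matrix.mul_assoc], h, Matrix.mul_zero, Matrix.zero_mul, Matrix.zero_mul]

/-- the same with [B4]'s adjacency predicate `B4RandomWalk213.cubeAdj` on labels `j ∈ Z^d` (`d`-tuples; `pos = id`):
`cubeAdj id i l ↔ ∀ μ, |i_μ − l_μ| ≤ 1`. [cite: Balaban1983RegularityDecay, (2.13) p.577] -/
theorem cubeAdj_id_iff {d : ℕ} (i l : Fin d → ℤ) :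
    B4RandomWalk213.cubeAdj (fun j : Fin d → ℤ => j) i l ↔ ∀ μ, |i μ - l μ| ≤ 1 := Iff.rfl

/-- «the obvious fact» for labels in `Z^d` phrased with `B4RandomWalk213.cubeAdj`: `¬ cubeAdj i l ⇒ h_iK_l = 0`.
[cite: Balaban1983RegularityDecay, (2.13) p.577] -/
theorem mulH_hCube_mul_opK_eq_zero_of_not_cubeAdj {d : ℕ} {M : ℝ} (hM : 0 < M) (pos : X → Fin d → ℝ)
    (c : X → X → ℝ) (m2 a : ℝ) (q : Y → X → ℝ) (W : X → X → Matrix κ κ ℝ) (T : Y → X → Matrix κ κ ℝ)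
    (hc : ∀ z z', c z z' ≠ 0 → ∀ μ, |pos z μ - pos z' μ| ≤ 3 / 4 * M)
    (hq : ∀ y z z', q y z ≠ 0 → q y z' ≠ 0 → ∀ μ, |pos z μ - pos z' μ| ≤ 3 / 4 * M)
    {i l : Fin d → ℤ} (hil : ¬ B4RandomWalk213.cubeAdj (fun j : Fin d → ℤ => j) i l) :
    mulH (ι := κ) (fun z => hCube M i (pos z)) * opK c m2 a q W T (fun z => hCube M l (pos z)) = 0 :=
  mulH_hCube_mul_opK_eq_zero hM pos c m2 a q W T hc hq hil

end Literature.MathematicalPhysics.QuantumFieldTheory.Balaban1983to89.B4Eq213Locality
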